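import Summits.Ventures.HodgeRepro2.Reflex
import Summits.Ventures.HodgeRepro2.GaloisSextic
import Summits.Ventures.HodgeRepro2.SexticGalois
import Summits.Ventures.HodgeRepro2.T6B4Vertex

/-!
# T6B4NonPrimitive — Lemma B4.2(ii) in kernel: the non-primitive vertex is induced from the
quadratic subfield, and B3 Application (ii) assembled (Tier 6, sub-goal B4)

Cell pub-hodge-repro2, owner t6-p7 (route/T6-B4-t6-p7.md). TIER4 §B4 Lemma B4.2(ii) says that for
the sextic Galois CM field `F` a NON-primitive CM type `Φ` has stabiliser `H` of order 3, reflex field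
`F₀ = Fix(H)` imaginary quadratic, and that `Φ` is one of the two types INDUCED from `F₀`; B3
Application (ii) then applies Prop. B4.3 to it. In kernel:
* `two_mul_ncard_of_isCMTypeOn` — a CM type on a finite group has half the elements of the group;
* `mem_iff_inv_mul_mem_of_ncard_eq`, `image_galEmb_eq_inducedSet_singleton` — a set of Galois elements
  with `|S| = |typeStabilizer S|` (abelian Galois group) is a single coset `uH`, so the CM type
  `{τ₁ ∘ s : s ∈ S}` is `{σ : σ|_{F₀} = (τ₁ ∘ u)|_{F₀}}` = the type induced from `(F₀, {ψ₀})`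
  (Galois correspondence `IntermediateField.fixingSubgroup_fixedField`);
* `nonPrimitive_eq_inducedSet` (+ the Finset form `nonPrimitive_eq_inducedSet'`) — for `[F : ℚ] = 6`
  and `Φ` non-primitive: `[F₀ : ℚ] = 2`, `F₀/ℚ` Galois, `Φ = inducedSet {ψ₀}` (p1's
  `card_eq_one_or_three_of_galConj_notMem`, `conj_not_mem_typeStabilizer`,
  `isMulCommutative_gal_of_finrank_six`, Mathlib's `IsGalois.card_aut_eq_finrank`,
  `IsGalois.of_fixedField_normal_subgroup`, `IntermediateField.finrank_fixedField_eq_card`);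
* `exists_factor_fixedField` — `M_μ = τ₁(F₀)` (Shimura Prop. 28 = p1's
  `traceField_eq_fixedField_typeStabilizer` + `map_traceField`), so `M_μ ⊆ M̃_μ` gives `ι₀ : F₀ → M̃_μ`;
* **`B4_nonPrimitive`** — the assembly: under (Eq) + (D) for `Φ_μ = Φ`, `Φ̃(τ₁)` is the CM type of
  `M̃_μ` induced from `(F₀′, {ψ₀*})` (`B4_inducedVertex` of T6B4Vertex.lean), Lemma B4.4's hypothesis
  for the non-primitive vertex;
* **`B4_dichotomy`** — Application (i) + (ii) in one statement: every CM type of the sextic field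
  is either primitive (then `B4_primitive`) or induced from a quadratic subfield (then `B4_nonPrimitive`);
  `B4_dichotomy_set` (the Set form) and **`B4_parityTetrahedron`** (the four vertices `T_i` of the
  brief's face with `Φ_{μ_i} = T_i⁻¹`: the primitive branch returns the type induced from `(F₁, T_i)`).
Proof lane: 0 sorry; axioms ⊆ {propext, Classical.choice, Quot.sound}.
§8(d): uses an L-value-free non-vanishing device: NO.
-/

namespace Summit.Ventures.HodgeRepro2.T6.B4NonPrimitive

open Summit.Ventures.HodgeRepro2 Summit.Ventures.HodgeRepro2.T6.B4Interface
  Summit.Ventures.HodgeRepro2.T6.B4Main Summit.Ventures.HodgeRepro2.T6.B4Vertex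

variable {K : Type*} [Field K] [NumberField K] [IsGalois ℚ K]

omit [IsGalois ℚ K] in
/-- For an abelian Galois group, a finite set `S` of Galois elements whose post-composition
stabiliser `H = typeStabilizer S` has as many elements as `S` is a single coset `S = uH` of `H`, for
every `u ∈ S`: `s ∈ S ⟺ u⁻¹ * s ∈ H`. -/
theorem mem_iff_inv_mul_mem_of_ncard_eq (hcomm : ∀ a b : K ≃ₐ[ℚ] K, a * b = b * a)
    (S : Set (K ≃ₐ[ℚ] K)) (hfin : S.Finite) (hcard : S.ncard = Nat.card (typeStabilizer S))
    {u : K ≃ₐ[ℚ] K} (hu : u ∈ S) (s : K ≃ₐ[ℚ] K) :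
    s ∈ S ↔ u⁻¹ * s ∈ typeStabilizer S := by
  -- uH ⊆ S
  have hsub : (fun h : K ≃ₐ[ℚ] K => u * h) '' (typeStabilizer S : Set (K ≃ₐ[ℚ] K)) ⊆ S := by
    rintro _ ⟨h, hh, rfl⟩
    have := (mem_typeStabilizer_iff_forall S h).1 hh u
    show u * h ∈ S
    rw [hcomm u h]
    exact this.2 hu
  -- |uH| = |H| = |S|, so uH = S
  have hncard : ((fun h : K ≃ₐ[ℚ] K => u * h) '' (typeStabilizer S : Set (K ≃ₐ[ℚ] K))).ncard =
      S.ncard := by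
    rw [Set.ncard_image_of_injective _ (mul_right_injective u), hcard]
    rfl
  have heq : (fun h : K ≃ₐ[ℚ] K => u * h) '' (typeStabilizer S : Set (K ≃ₐ[ℚ] K)) = S :=
    Set.eq_of_subset_of_ncard_le hsub hncard.ge hfin
  constructor
  · intro hs
    have : s ∈ (fun h : K ≃ₐ[ℚ] K => u * h) '' (typeStabilizer S : Set (K ≃ₐ[ℚ] K)) := by
      rw [heq]; exact hs
    obtain ⟨h, hh, rfl⟩ := this
    simpa using hh
  · intro hs
    have : s ∈ (fun h : K ≃ₐ[ℚ] K => u * h) '' (typeStabilizer S : Set (K ≃ₐ[ℚ] K)) :=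
      ⟨u⁻¹ * s, hs, by simp⟩
    rw [heq] at this
    exact this

/-- **A CM type that is a single coset of its stabiliser is induced from the fixed field of the
stabiliser** (Lemma B4.2(ii)'s «the types induced from F₀ = Fix(H*)»): with `H = typeStabilizer S`,
`F₀ = fixedField H`, `u ∈ S` and `ψ₀ := (τ₁ ∘ u)|_{F₀}`, the CM type `Φ = {τ₁ ∘ s : s ∈ S}` equals
`{σ : σ|_{F₀} = ψ₀}` = `inducedSet {ψ₀}` (Galois correspondence `fixingSubgroup_fixedField`). -/
theorem image_galEmb_eq_inducedSet_singleton (τ₁ : K →+* ℂ)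
    (hcomm : ∀ a b : K ≃ₐ[ℚ] K, a * b = b * a)
    (S : Set (K ≃ₐ[ℚ] K)) (hfin : S.Finite) (hcard : S.ncard = Nat.card (typeStabilizer S))
    {u : K ≃ₐ[ℚ] K} (hu : u ∈ S) :
    (galEmb K τ₁) '' S =
      inducedSet (K := IntermediateField.fixedField (typeStabilizer S)) (L := K)
        {(galEmb K τ₁ u).comp (algebraMap (IntermediateField.fixedField (typeStabilizer S)) K)} := by
  ext σ
  obtain ⟨s, rfl⟩ := (galEmb K τ₁).surjective σ
  rw [mem_inducedSet_iff, Set.mem_singleton_iff,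
    (galEmb K τ₁).injective.mem_set_image]
  rw [mem_iff_inv_mul_mem_of_ncard_eq hcomm S hfin hcard hu s]
  -- u⁻¹ * s ∈ H ⟺ u⁻¹ * s fixes F₀ pointwise ⟺ (τ₁ ∘ s)|_{F₀} = (τ₁ ∘ u)|_{F₀}
  have hfixing : u⁻¹ * s ∈ typeStabilizer S ↔
      ∀ x ∈ IntermediateField.fixedField (typeStabilizer S), (u⁻¹ * s) x = x := by
    rw [← IntermediateField.mem_fixingSubgroup_iff, IntermediateField.fixingSubgroup_fixedField]
  rw [hfixing]
  simp only [galEmb_apply]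
  constructor
  · intro hfix
    ext x
    simp only [RingHom.coe_comp, Function.comp_apply, IntermediateField.algebraMap_apply]
    have := hfix x x.2
    simp only [AlgEquiv.mul_apply] at this
    have h2 : s (x : K) = u (x : K) := by
      have := congrArg u this
      simpa using this
    simp [h2]
  · intro heq x hx
    have := RingHom.congr_fun heq ⟨x, hx⟩
    simp only [RingHom.coe_comp, Function.comp_apply, IntermediateField.algebraMap_apply] at this
    have h2 : s x = u x := τ₁.injective this
    simp [AlgEquiv.mul_apply, h2]

/-- A CM type on a finite group with respect to an involution `ρ` has half the elements of the
group: `2 · |S| = |G|` (the map `g ↦ ρ g` exchanges `S` and its complement). -/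
theorem two_mul_ncard_of_isCMTypeOn {G : Type*} [Group G] [Finite G] {ρ : G} (hρ : ρ * ρ = 1)
    {S : Set G} (hS : IsCMTypeOn ρ S) : 2 * S.ncard = Nat.card G := by
  have hcompl : Sᶜ = (fun g => ρ * g) '' S := by
    ext g
    constructor
    · intro hg
      refine ⟨ρ * g, ?_, by show ρ * (ρ * g) = g; rw [← mul_assoc, hρ, one_mul]⟩
      have := hS g
      rcases this with ⟨h1, _⟩ | ⟨h1, _⟩
      · exact absurd h1 hg
      · exact h1
    · rintro ⟨x, hx, rfl⟩
      have := hS x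
      rcases this with ⟨_, h2⟩ | ⟨_, h2⟩
      · exact h2
      · exact absurd hx h2
  have h1 : S.ncard + Sᶜ.ncard = Nat.card G := Set.ncard_add_ncard_compl S
  rw [hcompl, Set.ncard_image_of_injective _ (mul_right_injective ρ)] at h1
  omega

/-- **Lemma B4.2(ii) in kernel — the non-primitive vertex is induced from the quadratic subfield**:
for a Galois CM field `K` of degree 6 and a NON-primitive CM type `Φ` of `K`, with `S = {u : τ₁ ∘ u ∈ Φ}`
and `H = typeStabilizer S` (of order 3), the fixed field `F₀ = fixedField H` has degree 2 over ℚ, is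
Galois over ℚ, and `Φ = {σ : σ|_{F₀} = ψ₀}` is the CM type INDUCED from `(F₀, {ψ₀})`, where
`ψ₀ = (τ₁ ∘ u)|_{F₀}` for any `u ∈ S` — TIER4 Application (ii)'s «T₄ = {σ ∈ Σ : σ|_{F₀} = ψ₀}». -/
theorem nonPrimitive_eq_inducedSet [NumberField.IsCMField K] (h6 : Module.finrank ℚ K = 6)
    (τ₁ : K →+* ℂ) (Φ : Set (K →+* ℂ)) (hΦ : IsCMType K Φ)
    (hnp : ¬ IsPrimitiveOn ((galEmb K τ₁) ⁻¹' Φ)) :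
    Module.finrank ℚ (IntermediateField.fixedField (typeStabilizer ((galEmb K τ₁) ⁻¹' Φ))) = 2 ∧
    IsGalois ℚ (IntermediateField.fixedField (typeStabilizer ((galEmb K τ₁) ⁻¹' Φ))) ∧
    ∀ u ∈ (galEmb K τ₁) ⁻¹' Φ,
      Φ = inducedSet (K := IntermediateField.fixedField (typeStabilizer ((galEmb K τ₁) ⁻¹' Φ)))
        (L := K) {(galEmb K τ₁ u).comp
          (algebraMap (IntermediateField.fixedField (typeStabilizer ((galEmb K τ₁) ⁻¹' Φ))) K)} := by
  classical
  set S : Set (K ≃ₐ[ℚ] K) := (galEmb K τ₁) ⁻¹' Φ with hSdef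
  have hcomm : ∀ a b : K ≃ₐ[ℚ] K, a * b = b * a := by
    haveI := isMulCommutative_gal_of_finrank_six K h6
    intro a b; exact IsMulCommutative.is_comm.comm a b
  -- |G| = 6
  have hG : Nat.card (K ≃ₐ[ℚ] K) = 6 := by rw [IsGalois.card_aut_eq_finrank, h6]
  -- |S| = 3
  have hcm : IsCMTypeOn (galConj K) S := (isCMType_iff_isCMTypeOn K τ₁ Φ).1 hΦ
  have hS3 : S.ncard = 3 := by
    have := two_mul_ncard_of_isCMTypeOn (galConj_mul_self K) hcm
    omega
  -- |H| = 3
  have hHne : typeStabilizer S ≠ ⊥ := by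
    intro hbot
    exact hnp ((isPrimitiveOn_iff_typeStabilizer_eq_bot S).2 hbot)
  have hH3 : Nat.card (typeStabilizer S) = 3 := by
    rcases card_eq_one_or_three_of_galConj_notMem K h6 (typeStabilizer S)
        (conj_not_mem_typeStabilizer hcm) with h | h
    · exact absurd (Subgroup.card_eq_one.1 h) hHne
    · exact h
  -- H is normal (G abelian), so F₀ is Galois over ℚ
  haveI hnormal : (typeStabilizer S).Normal :=
    ⟨fun n hn g => by rw [hcomm g n, mul_assoc, mul_inv_cancel, mul_one]; exact hn⟩
  refine ⟨?_, IsGalois.of_fixedField_normal_subgroup (typeStabilizer S), ?_⟩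
  · -- [F₀ : ℚ] = 6 / 3 = 2
    have ht : Module.finrank ℚ (IntermediateField.fixedField (typeStabilizer S)) *
        Module.finrank (IntermediateField.fixedField (typeStabilizer S)) K = Module.finrank ℚ K :=
      Module.finrank_mul_finrank ℚ (IntermediateField.fixedField (typeStabilizer S)) K
    rw [IntermediateField.finrank_fixedField_eq_card, hH3, h6] at ht
    omega
  · intro u hu
    have hfin : S.Finite := Set.toFinite S
    have hcard : S.ncard = Nat.card (typeStabilizer S) := by rw [hS3, hH3]
    have key := image_galEmb_eq_inducedSet_singleton τ₁ hcomm S hfin hcard hu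
    rwa [hSdef, Set.image_preimage_eq _ (galEmb K τ₁).surjective, ← hSdef] at key

open Classical in
/-- The Finset form of `nonPrimitive_eq_inducedSet`, aligned with `B4_primitive`: `Φ = {τ₁ ∘ u : u ∈ S}`
for a Finset `S` of Galois elements. -/
theorem nonPrimitive_eq_inducedSet' [NumberField.IsCMField K] (h6 : Module.finrank ℚ K = 6)
    (τ₁ : K →+* ℂ) (S : Finset (K ≃ₐ[ℚ] K))
    (hΦ : IsCMType K (↑(S.image (galEmb K τ₁)) : Set (K →+* ℂ)))
    (hnp : ¬ IsPrimitiveOn (S : Set (K ≃ₐ[ℚ] K))) :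
    Module.finrank ℚ (IntermediateField.fixedField (typeStabilizer (S : Set (K ≃ₐ[ℚ] K)))) = 2 ∧
    IsGalois ℚ (IntermediateField.fixedField (typeStabilizer (S : Set (K ≃ₐ[ℚ] K)))) ∧
    ∀ u ∈ S,
      (↑(S.image (galEmb K τ₁)) : Set (K →+* ℂ)) =
        inducedSet (K := IntermediateField.fixedField (typeStabilizer (S : Set (K ≃ₐ[ℚ] K))))
          (L := K) {(galEmb K τ₁ u).comp
            (algebraMap (IntermediateField.fixedField (typeStabilizer (S : Set (K ≃ₐ[ℚ] K)))) K)} := by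
  have hpre : (galEmb K τ₁) ⁻¹' (↑(S.image (galEmb K τ₁)) : Set (K →+* ℂ)) = (S : Set _) := by
    rw [Finset.coe_image, Set.preimage_image_eq _ (galEmb K τ₁).injective]
  have := nonPrimitive_eq_inducedSet h6 τ₁ (↑(S.image (galEmb K τ₁)) : Set (K →+* ℂ)) hΦ
    (by rw [hpre]; exact hnp)
  rw [hpre] at this
  exact ⟨this.1, this.2.1, fun u hu => this.2.2 u (Finset.mem_coe.2 hu)⟩

open Classical in
/-- **Lemma B4.2(ii) in the form B4 uses it**: the reflex field of `Φ = {τ₁ ∘ u : u ∈ S}` is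
`M_μ = τ₁(F₀)`, `F₀ = fixedField (typeStabilizer S)` (Shimura 1998 Prop. 28 = p1's
`traceField_eq_fixedField_typeStabilizer` + `map_traceField`), so `M_μ ⊆ M̃_μ` (Liu p. 41 l. 49)
gives an embedding `ι₀ : F₀ → M̃_μ` over `τ₁|_{F₀}`. -/
theorem exists_factor_fixedField (τ₁ : K →+* ℂ) (S : Finset (K ≃ₐ[ℚ] K))
    (M : IntermediateField ℚ ℂ) (hM : complexTraceField (S.image (galEmb K τ₁)) ≤ M) :
    ∃ ι₀ : IntermediateField.fixedField (typeStabilizer (S : Set (K ≃ₐ[ℚ] K))) →+* M,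
      (algebraMap M ℂ).comp ι₀ =
        τ₁.comp (algebraMap (IntermediateField.fixedField (typeStabilizer (S : Set (K ≃ₐ[ℚ] K)))) K) := by
  have hmem : ∀ x : IntermediateField.fixedField (typeStabilizer (S : Set (K ≃ₐ[ℚ] K))),
      τ₁ (x : K) ∈ M := by
    intro x
    apply hM
    rw [← map_traceField τ₁ S, traceField_eq_fixedField_typeStabilizer]
    exact ⟨x, x.2, rfl⟩
  refine ⟨RingHom.codRestrict (τ₁.comp (algebraMap _ K)) M (fun x => hmem x), ?_⟩
  ext x
  rfl

open Classical in
/-- **B3 Application (ii), the non-primitive vertex, assembled**: for a Galois CM field `K` of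
degree 6, a NON-primitive CM type `Φ = {τ₁ ∘ u : u ∈ S}` with `M_μ ⊆ M̃_μ`, under (Eq) and (D) for
`Φ_μ = Φ` there are a quadratic Galois subfield `F₀ ⊆ K` (the fixed field of the stabiliser),
an embedding `ψ₀ : F₀ → ℂ` with `Φ = {σ : σ|_{F₀} = ψ₀}` and an embedding `ι₀ : F₀ → M̃_μ` over
`τ₁|_{F₀}`, such that `Φ̃(τ₁) = {θ : θ ∘ ι₀ = ψ₀}` is the CM type of `M̃_μ` INDUCED from `(F₀′, {ψ₀*})`
— Lemma B4.4's hypothesis with `(M̃, K, T) = (M̃_μ, F₀′, {ψ₀*})`. -/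
theorem B4_nonPrimitive [NumberField.IsCMField K] (h6 : Module.finrank ℚ K = 6)
    (τ₁ : K →+* ℂ) (S : Finset (K ≃ₐ[ℚ] K))
    (hΦ : IsCMType K (↑(S.image (galEmb K τ₁)) : Set (K →+* ℂ)))
    (hnp : ¬ IsPrimitiveOn (S : Set (K ≃ₐ[ℚ] K)))
    (M : IntermediateField ℚ ℂ) [FiniteDimensional ℚ M]
    (hM : complexTraceField (S.image (galEmb K τ₁)) ≤ M)
    (Φt : (K →+* ℂ) → Set (M →+* ℂ)) (hEq : EqCompat M Φt)
    (hD : HodgeDictionary M (↑(S.image (galEmb K τ₁)) : Set (K →+* ℂ)) Φt) :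
    ∃ (F₀ : IntermediateField ℚ K) (ψ₀ : F₀ →+* ℂ) (ι₀ : F₀ →+* M),
      Module.finrank ℚ F₀ = 2 ∧
      (↑(S.image (galEmb K τ₁)) : Set (K →+* ℂ)) = inducedSet (K := F₀) (L := K) {ψ₀} ∧
      (algebraMap M ℂ).comp ι₀ = τ₁.comp (algebraMap F₀ K) ∧
      Φt τ₁ = @inducedSet F₀ _ M _ ι₀.toAlgebra {ψ₀} := by
  obtain ⟨h2, hgal, hind⟩ := nonPrimitive_eq_inducedSet' h6 τ₁ S hΦ hnp
  -- S is nonempty (a CM type has three elements)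
  have hne : S.Nonempty := by
    by_contra hemp
    rw [Finset.not_nonempty_iff_eq_empty] at hemp
    subst hemp
    have := hΦ τ₁
    simp at this
  obtain ⟨u, hu⟩ := hne
  set F₀ := IntermediateField.fixedField (typeStabilizer (S : Set (K ≃ₐ[ℚ] K))) with hF₀
  set ψ₀ : F₀ →+* ℂ := (galEmb K τ₁ u).comp (algebraMap F₀ K) with hψ₀
  obtain ⟨ι₀, hι₀⟩ := exists_factor_fixedField τ₁ S M hM
  haveI : IsGalois ℚ F₀ := hgal
  obtain ⟨c, hc, hψ⟩ := exists_involution_of_finrank_two F₀ h2 (τ₁.comp (algebraMap F₀ K)) ψ₀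
  refine ⟨F₀, ψ₀, ι₀, h2, hind u hu, hι₀, ?_⟩
  have hD' : HodgeDictionary M (inducedSet (K := F₀) (L := K) {ψ₀}) Φt := by
    rw [← hind u hu]; exact hD
  exact B4_inducedVertex τ₁ F₀ ψ₀ c hc hψ M ι₀ hι₀ Φt hEq hD'

open Classical in
/-- **The B4 dichotomy for the sextic Galois CM field** (TIER4 B3 Application (i) + (ii) in one
statement): for EVERY CM type `Φ = {τ₁ ∘ u : u ∈ S}` of `K` with `M_μ ⊆ M̃_μ`, under (Eq) and (D),
EITHER `Φ` is primitive, `F₁ = τ₁(F) ⊆ M̃_μ` and `Φ̃(τ₁)` is the type induced from `(F₁, Φ⁻¹)`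
(`B4_primitive`), OR `Φ` is induced from a quadratic Galois subfield `F₀` through `ψ₀`, `F₀′ ⊆ M̃_μ`
and `Φ̃(τ₁)` is the type induced from `(F₀′, {ψ₀*})` (`B4_nonPrimitive`). With `Φ = T_i⁻¹` for a
vertex `T_i` of the parity tetrahedron, `Φ⁻¹ = T_i` (`inverseType_inverseType`) and the first branch
is the brief's threefold of type `T_i`; the second branch is the one non-primitive vertex
(`card_nonPrimitive_parityTetrahedron`). -/
theorem B4_dichotomy [NumberField.IsCMField K] (h6 : Module.finrank ℚ K = 6)
    (τ₁ : K →+* ℂ) (S : Finset (K ≃ₐ[ℚ] K))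
    (hΦ : IsCMType K (↑(S.image (galEmb K τ₁)) : Set (K →+* ℂ)))
    (M : IntermediateField ℚ ℂ) [FiniteDimensional ℚ M]
    (hM : complexTraceField (S.image (galEmb K τ₁)) ≤ M)
    (Φt : (K →+* ℂ) → Set (M →+* ℂ)) (hEq : EqCompat M Φt)
    (hD : HodgeDictionary M (↑(S.image (galEmb K τ₁)) : Set (K →+* ℂ)) Φt) :
    (IsPrimitiveOn (S : Set (K ≃ₐ[ℚ] K)) ∧ ∃ ι : K →+* M, (algebraMap M ℂ).comp ι = τ₁ ∧
        Φt τ₁ = @inducedSet K _ M _ ι.toAlgebra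
          (inverseType K τ₁ (↑(S.image (galEmb K τ₁)) : Set (K →+* ℂ)))) ∨
    (¬ IsPrimitiveOn (S : Set (K ≃ₐ[ℚ] K)) ∧
      ∃ (F₀ : IntermediateField ℚ K) (ψ₀ : F₀ →+* ℂ) (ι₀ : F₀ →+* M),
        Module.finrank ℚ F₀ = 2 ∧
        (↑(S.image (galEmb K τ₁)) : Set (K →+* ℂ)) = inducedSet (K := F₀) (L := K) {ψ₀} ∧
        (algebraMap M ℂ).comp ι₀ = τ₁.comp (algebraMap F₀ K) ∧
        Φt τ₁ = @inducedSet F₀ _ M _ ι₀.toAlgebra {ψ₀}) := by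
  by_cases hS : IsPrimitiveOn (S : Set (K ≃ₐ[ℚ] K))
  · exact Or.inl ⟨hS, B4_primitive τ₁ S hS M hM Φt hEq hD⟩
  · exact Or.inr ⟨hS, B4_nonPrimitive h6 τ₁ S hΦ hS M hM Φt hEq hD⟩

open Classical in
/-- `B4_dichotomy` for a CM type given as a SET `Φ ⊆ Σ` (the form of TIER4: `Φ_{μ_i} = T_i⁻¹`,
`inverseType τ₁ (parityTetrahedron K τ i)`): with `S = {u : τ₁ ∘ u ∈ Φ}`, either `Φ` is primitive and
`Φ̃(τ₁)` is induced from `(F₁, Φ⁻¹)`, or `Φ` is induced from a quadratic Galois subfield `F₀` via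
`ψ₀` and `Φ̃(τ₁)` is induced from `(F₀′, {ψ₀*})`. -/
theorem B4_dichotomy_set [NumberField.IsCMField K] (h6 : Module.finrank ℚ K = 6)
    (τ₁ : K →+* ℂ) (Φ : Set (K →+* ℂ)) (hΦ : IsCMType K Φ)
    (M : IntermediateField ℚ ℂ) [FiniteDimensional ℚ M] (hM : complexTraceField Φ.toFinset ≤ M)
    (Φt : (K →+* ℂ) → Set (M →+* ℂ)) (hEq : EqCompat M Φt) (hD : HodgeDictionary M Φ Φt) :
    (IsPrimitiveOn ((galEmb K τ₁) ⁻¹' Φ) ∧ ∃ ι : K →+* M, (algebraMap M ℂ).comp ι = τ₁ ∧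
        Φt τ₁ = @inducedSet K _ M _ ι.toAlgebra (inverseType K τ₁ Φ)) ∨
    (¬ IsPrimitiveOn ((galEmb K τ₁) ⁻¹' Φ) ∧
      ∃ (F₀ : IntermediateField ℚ K) (ψ₀ : F₀ →+* ℂ) (ι₀ : F₀ →+* M),
        Module.finrank ℚ F₀ = 2 ∧ Φ = inducedSet (K := F₀) (L := K) {ψ₀} ∧
        (algebraMap M ℂ).comp ι₀ = τ₁.comp (algebraMap F₀ K) ∧
        Φt τ₁ = @inducedSet F₀ _ M _ ι₀.toAlgebra {ψ₀}) := by
  set S : Finset (K ≃ₐ[ℚ] K) := ((galEmb K τ₁) ⁻¹' Φ).toFinset with hSdef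
  have hScoe : (S : Set (K ≃ₐ[ℚ] K)) = (galEmb K τ₁) ⁻¹' Φ := by
    rw [hSdef, Set.coe_toFinset]
  have himg : (↑(S.image (galEmb K τ₁)) : Set (K →+* ℂ)) = Φ := by
    rw [Finset.coe_image, hScoe, Set.image_preimage_eq _ (galEmb K τ₁).surjective]
  have himgF : S.image (galEmb K τ₁) = Φ.toFinset := by
    apply Finset.coe_injective
    rw [himg, Set.coe_toFinset]
  have hΦ' : IsCMType K (↑(S.image (galEmb K τ₁)) : Set (K →+* ℂ)) := by rw [himg]; exact hΦ
  have hM' : complexTraceField (S.image (galEmb K τ₁)) ≤ M := by rw [himgF]; exact hM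
  have hD' : HodgeDictionary M (↑(S.image (galEmb K τ₁)) : Set (K →+* ℂ)) Φt := by
    rw [himg]; exact hD
  rcases B4_dichotomy h6 τ₁ S hΦ' M hM' Φt hEq hD' with ⟨hp, ι, hι, hΦt⟩ | ⟨hnp, F₀, ψ₀, ι₀, h2, hind, hι₀, hΦt⟩
  · refine Or.inl ⟨by rwa [hScoe] at hp, ι, hι, ?_⟩
    rw [hΦt, himg]
  · refine Or.inr ⟨by rwa [hScoe] at hnp, F₀, ψ₀, ι₀, h2, ?_, hι₀, hΦt⟩
    rw [← himg]; exact hind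

open Classical in
/-- **The four vertices of the parity tetrahedron** (CLAIM (B4-I)/(B4-II) for the brief's face):
for the sextic Galois CM field `K`, an injective CM type `τ : Fin 3 → Σ`, a vertex
`T_i = parityTetrahedron K τ i` and the character type `Φ_{μ_i} := T_i⁻¹` (TIER4: «one must take
`Φ_{μ_i} = T_i⁻¹`»), with `M_{μ_i} ⊆ M̃_{μ_i}` and (Eq), (D): EITHER `T_i⁻¹` is primitive, `F₁ ⊆ M̃_{μ_i}`
and `Φ̃(τ₁)` is the CM type induced from `(F₁, T_i)` — the brief's threefold of type `T_i`
(`(T_i⁻¹)⁻¹ = T_i`, `inverseType_inverseType`) — OR `T_i⁻¹` is the non-primitive vertex, induced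
from a quadratic Galois `F₀` via `ψ₀`, `F₀′ ⊆ M̃_{μ_i}`, and `Φ̃(τ₁)` is induced from `(F₀′, {ψ₀*})`. -/
theorem B4_parityTetrahedron [NumberField.IsCMField K] (h6 : Module.finrank ℚ K = 6)
    (τ₁ : K →+* ℂ) (τ : Fin 3 → (K →+* ℂ)) (hinj : Function.Injective τ)
    (hτ : IsCMType K (Set.range τ)) (i : Fin 4)
    (M : IntermediateField ℚ ℂ) [FiniteDimensional ℚ M]
    (hM : complexTraceField (inverseType K τ₁ (parityTetrahedron K τ i)).toFinset ≤ M)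
    (Φt : (K →+* ℂ) → Set (M →+* ℂ)) (hEq : EqCompat M Φt)
    (hD : HodgeDictionary M (inverseType K τ₁ (parityTetrahedron K τ i)) Φt) :
    (IsPrimitiveOn ((galEmb K τ₁) ⁻¹' inverseType K τ₁ (parityTetrahedron K τ i)) ∧
        ∃ ι : K →+* M, (algebraMap M ℂ).comp ι = τ₁ ∧
          Φt τ₁ = @inducedSet K _ M _ ι.toAlgebra (parityTetrahedron K τ i)) ∨
    (¬ IsPrimitiveOn ((galEmb K τ₁) ⁻¹' inverseType K τ₁ (parityTetrahedron K τ i)) ∧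
      ∃ (F₀ : IntermediateField ℚ K) (ψ₀ : F₀ →+* ℂ) (ι₀ : F₀ →+* M),
        Module.finrank ℚ F₀ = 2 ∧
        inverseType K τ₁ (parityTetrahedron K τ i) = inducedSet (K := F₀) (L := K) {ψ₀} ∧
        (algebraMap M ℂ).comp ι₀ = τ₁.comp (algebraMap F₀ K) ∧
        Φt τ₁ = @inducedSet F₀ _ M _ ι₀.toAlgebra {ψ₀}) := by
  have hΦ : IsCMType K (inverseType K τ₁ (parityTetrahedron K τ i)) :=
    isCMType_inverseType K τ₁ ((isWeilFace_parityTetrahedron K τ hinj hτ).1 i)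
  rcases B4_dichotomy_set h6 τ₁ _ hΦ M hM Φt hEq hD with ⟨hp, ι, hι, hΦt⟩ | h
  · refine Or.inl ⟨hp, ι, hι, ?_⟩
    rw [hΦt, inverseType_inverseType]
  · exact Or.inr h

end Summit.Ventures.HodgeRepro2.T6.B4NonPrimitive
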